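import Summits.MatrixMultiplication.MatrixMultiplication.Theses.HenselReesLifting
import Literature.Computability.AlgebraicComplexity.ExteriorTensor
import Literature.Computability.AlgebraicComplexity.AsymptoticRankLimit

/-!
# Crux `CliffordReduction` (stmt-MatrixMultiplication-3851) — `Lines/birth.lean`, the BC3 birth skeleton

Route `HenselReesLifting` (route-MatrixMultiplication-HenselReesLifting; deciding theorem
`closes : ExteriorExponentOne → CliffordReduction → CliffordMatrixModel → MatrixMultiplication`,
proved in the route file).  The crux, in the named tensors of
`Literature/Computability/AlgebraicComplexity/ExteriorTensor.lean` (which unfold BY `rfl` to the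
route's inlined lambdas — `cliffordTensor_eq`, `exteriorTensor_eq`, `reesCliffordTensor_eq`; the
bridge is re-checked below as `cliffordReduction_iff` / `reesLiftClifford_iff`, both `Iff.rfl`):

  `CliffordReduction : ∀ ε > 0, ∀ᶠ n, R̃(T_{Cl_n}) ≤ 2^{εn} · R̃(T_{Λ_n})`   ("ω ≤ 2·e_Λ")

with `T_{Cl_n} = cliffordTensor ℂ n`, `T_{Λ_n} = exteriorTensor ℂ n` on the Boolean cube
`Finset (Fin n)` and `R̃ = asymptoticRank` (Kronecker powers over `ℂ`).

## The line: Rees lift → Bini coefficient extraction at `t = 1` → sub-exponential transfer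

This is the route header's OWN mechanism for the crux ("The intended proof is NOT a degeneration
(impossible, IrreversibilityBarrier: Q̃(T_{Λ_n}) ≤ 2^{0.9183 n}) but the Rees lift of crux
ReesLiftClifford … Implies CliffordReduction by coefficient extraction (support ReesToReduction)"),
made kernel-checked: the support item `ReesToReduction : ReesLiftClifford → CliffordReduction`
(stmt-MatrixMultiplication-3857, informal proof in its docstring) is cut into its two genuine
lemmas (stubs 2 and 3) and the glue between them is PROVED here.

* `stub_reesLift` — **the engine**: the sibling crux `ReesLiftClifford` (stmt-MatrixMultiplication-3853,
  rank 5) BY NAME: for every `ε > 0`, eventually in `n` and then in `N`, the rank over `ℂ⟦t⟧` of the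
  `N`-th Kronecker power of the Rees tensor `T_t = reesCliffordTensor ℂ n`
  (`T_t(U,S,T) = [U = S Δ T] t^{|S∩T|} (−1)^{inv(S,T)}`; fibre `t = 0`: `T_{Λ_n}`, sum of coefficients
  = value at `t = 1`: `T_{Cl_n}`) is at most `2^{εnN} · R_ℂ(T_{Λ_n}^{⊠N})` — decompositions of the
  special fibre lift `t`-adically with sub-exponential padding.  Size XL / open (the route's bet; why
  it might fail: rank jumps up from special to generic fibre generically, the order-≥2 feedback may
  force padding `2^{cnN}`).  Load-bearing: it is the only place where `Cl` is compared with `Λ`.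
* `stub_coefficientExtraction` — **Bini's de-bordering at `t = 1` for the Rees family**:
  `R_ℂ(T_{Cl_n}^{⊠N}) ≤ (nN+1)(nN+2)/2 · R_{ℂ⟦t⟧}(T_t^{⊠N})` for all `n, N`.  Why true: the entries of
  `T_t^{⊠N}` are monomials `± t^d` of degree `d = Σ_j |S_j ∩ T_j| ≤ nN` whose coefficient sums are the
  entries of `T_{Cl_n}^{⊠N}` (`coeff_reesCliffordTensor`, `sum_coeff_reesCliffordTensor`, multiplied
  over the `N` coordinates); given `T_t^{⊠N} = Σ_{i<r} w_i(t) ⊗ u_i(t) ⊗ v_i(t)` over `ℂ⟦t⟧`, comparing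
  the coefficients of `t^d`, `d ≤ D = nN`, and regrouping
  `Σ_{α+β+γ ≤ D} w_{i,α} ⊗ u_{i,β} ⊗ v_{i,γ} = Σ_{α+β ≤ D} w_{i,α} ⊗ u_{i,β} ⊗ (Σ_{γ ≤ D−α−β} v_{i,γ})`
  gives `#{(α,β) : α+β ≤ D} · r = (D+1)(D+2)/2 · r` triads (Bini 1980; BCS 1997, (15.7)
  `t ⊴_q ⟨r⟩ ⇒ R(t) ≤ (q(q+1)/2)·r` and Prop. (15.26), held copy PDF pp. 414/424; Bläser 2013,
  Lemma 6.4 — the count is valid over any commutative ring; the tree's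
  `tensorRank_le_of_isPolyDegen` is the polynomial (`K[ε]`, order `h`) version with constant `(h+1)²`).
  Size M (power-series coefficient bookkeeping + `tensorRank_le_card_of_eq_sum`), PROVABLE NOW.
* `stub_asymptoticTransfer` — **sub-exponential factors are invisible at the exponent scale**: for
  tensors `s, t` over `ℂ` and `a ≥ 0`, if eventually `R(s^{⊠N}) ≤ c · N^p · a^N · R(t^{⊠N})` then
  `R̃(s) ≤ a · R̃(t)`.  Why true: `N`-th roots and Fekete on both sides
  (`advxxz2025_asymptoticRank_tendsto`: `R(t^{⊠N})^{1/N} → R̃(t)`), `(c N^p)^{1/N} → 1`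
  (`tendsto_rpow_div_mul_add`), `le_of_tendsto`; the case `s = 0` / `c ≤ 0` by `asymptoticRank_zero`
  — the pattern of BCS 1997, Lemma (15.27) (`R(φ^{⊗N}) ≤ (Nq)² r^N ⇒ limsup N⁻¹ log R(φ^{⊗N}) ≤ log r`,
  PDF p. 424) with a second tensor on the right.  Size S/M (real analysis), PROVABLE NOW.
* `cliffordReduction_of_lift_extraction_transfer` — the sorry-free CORE with the three stub statements
  as explicit hypotheses: for `ε > 0` take the lift at `ε/2`; for every large `n`, eventually in `N`,
  `R(T_{Cl_n}^{⊠N}) ≤ (nN+1)(nN+2)/2 · 2^{(ε/2)nN} · R(T_{Λ_n}^{⊠N}) ≤ (n+2)² · N² · (2^{(ε/2)n})^N · R(T_{Λ_n}^{⊠N})`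
  (`biniFactor_le`), so the transfer gives `R̃(T_{Cl_n}) ≤ 2^{(ε/2)n} R̃(T_{Λ_n}) ≤ 2^{εn} R̃(T_{Λ_n})`.
* `CliffordReduction_of : CliffordReduction` — THE skeleton theorem: the crux BY NAME from the three
  declared stubs (the only `sorry`s of the file) through the core and the `Iff.rfl` bridges.

Honest status.  Given stubs 2 and 3 (both provable now), stub 1 implies the crux and is plausibly
STRONGER (formal `t`-adic lifting at finite level with integral — `ℂ⟦t⟧` — decompositions); the
skeleton certifies the route's reduction "CliffordReduction ⇐ ReesLiftClifford" and isolates the two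
provable pieces, it does not split the open content of `ReesLiftClifford` itself (the route header's
TWO-LAYER PLAN foresees `ReesFirstOrder → QuadraticFeedback → ReesLiftClifford` for that, one level
down, once this crux is staffed).  Disproof used: none exists (`ledger crux ls
stmt-MatrixMultiplication-3851`: no workfiles, no `Disproof.lean`, no `Negative/` lemma; `ledger
negatives --problem MatrixMultiplication` has no statement about `cliffordTensor` / `exteriorTensor` /
`reesCliffordTensor`), so no `_false_without_` obligation applies.  Barrier honoured: no stub is a
degeneration `T_{Λ_n}^{⊠N} ⊵ T_{Cl_n}^{⊠N}` (impossible asymptotically, IrreversibilityBarrier);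
stub 1 compares RANKS of the two fibres, which upper semicontinuity does not forbid.

BC3 probes (planner-run with `lean check`, under `maxHeartbeats 400000`, files `bc/probe_*.lean` in the
planner folder): `stubᵢ → CliffordReduction` and `stubᵢ → _root_.MatrixMultiplication` for `i = 1, 2, 3`, each
in three shapes — `example : S → T := by first | exact? | simpa | aesop`, the in-context form
`example (h : S) : T := by first | exact? | simpa using h | aesop`, and the BC2 tactic
`first | exact? | simpa [ReesLiftClifford, CliffordReduction, MatrixMultiplication] | (unfold …; simpa) | aesop`
— all eighteen FAIL (rc 1: unsolved goals / aesop made no progress / heartbeat timeout; verdicts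
quoted in `Lines/birth.md`).
-/

-- `Summit.<Summit>.<Problem>`: for the single-conjunct summit the duplicate component is mandated.
set_option linter.dupNamespace false

noncomputable section

namespace Summit.MatrixMultiplication.MatrixMultiplication.Cruxes.CliffordReduction.Birth

open Filter Topology
open Literature.Computability.AlgebraicComplexity
open Summit.MatrixMultiplication.MatrixMultiplication.Theses.HenselReesLifting
  (CliffordReduction ReesLiftClifford)

/-! ## Bridges: the route's inlined lambdas are the named tensors, definitionally -/

/-- `CliffordReduction` is, definitionally, `∀ ε > 0, ∀ᶠ n, R̃(cliffordTensor ℂ n) ≤ 2^{εn} R̃(exteriorTensor ℂ n)`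
(`cliffordTensor_eq`, `exteriorTensor_eq` are `rfl`). [folklore] -/
theorem cliffordReduction_iff :
    CliffordReduction ↔
      ∀ ε : ℝ, 0 < ε → ∀ᶠ n : ℕ in atTop,
        asymptoticRank (cliffordTensor ℂ n) ≤
          (2 : ℝ) ^ (ε * n) * asymptoticRank (exteriorTensor ℂ n) :=
  Iff.rfl

/-- `ReesLiftClifford` is, definitionally, the `ℂ⟦t⟧`-rank bound for the Kronecker powers of
`reesCliffordTensor ℂ n` against those of `exteriorTensor ℂ n` (`reesCliffordTensor_eq` is `rfl`).
[folklore] -/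
theorem reesLiftClifford_iff :
    ReesLiftClifford ↔
      ∀ ε : ℝ, 0 < ε → ∀ᶠ n : ℕ in atTop, ∀ᶠ N : ℕ in atTop,
        (tensorRank (kroneckerPow (reesCliffordTensor ℂ n) N) : ℝ) ≤
          (2 : ℝ) ^ (ε * n * N) * (tensorRank (kroneckerPow (exteriorTensor ℂ n) N) : ℝ) :=
  Iff.rfl

/-! ## The three registered stubs (the only `sorry`s of this file) -/

/-- **Stub 1 — the Rees lift (engine; the sibling crux `ReesLiftClifford`, stmt-MatrixMultiplication-3853,
BY NAME).**  For every `ε > 0`, for all large `n` and then all large `N`: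
`R_{ℂ⟦t⟧}(T_t^{⊠N}) ≤ 2^{εnN} · R_ℂ(T_{Λ_n}^{⊠N})`, `T_t = reesCliffordTensor ℂ n` the Rees family
(`e_S·e_T = t^{|S∩T|}(−1)^{inv(S,T)} e_{SΔT}`) with special fibre `T_{Λ_n}` (`t = 0`) and value `T_{Cl_n}`
at `t = 1`.  Mechanism (route header): deform decompositions of `T_{Λ_n}^{⊠N}` order by order in `t`;
first order is free up to padding (the single-contraction part is a sum of `n` tensors `GL`-equivalent to
`T_{Λ_{n−1}}`), the open content is the quadratic feedback at orders `≥ 2`.  Size XL / open-problem.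
Sources: BurgisserClausenShokrollahi1997 (§15.5–15.6), Landsberg2017, BlaserLysikov2016 (§2.3),
arXiv:1609.07134. -/
theorem stub_reesLift :
    Summit.MatrixMultiplication.MatrixMultiplication.Theses.HenselReesLifting.ReesLiftClifford := by
  sorry

/-- **Stub 2 — Bini coefficient extraction at `t = 1` for the Rees family.**  For all `n, N`:
`R_ℂ(T_{Cl_n}^{⊠N}) ≤ (nN+1)(nN+2)/2 · R_{ℂ⟦t⟧}(T_t^{⊠N})`.  The entries of `T_t^{⊠N}` are monomials of
degree `≤ D = nN` whose coefficient sums are the entries of `T_{Cl_n}^{⊠N}` (`coeff_reesCliffordTensor`,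
`sum_coeff_reesCliffordTensor`); a rank-`r` decomposition over `ℂ⟦t⟧` yields, coefficient by coefficient
and after regrouping the third factor, `#{(α,β) : α+β ≤ D} · r = (D+1)(D+2)/2 · r` triads over `ℂ`
(Bini 1980; BCS 1997, (15.7) and Prop. (15.26); Bläser 2013, Lemma 6.4; cf. the tree's
`tensorRank_le_of_isPolyDegen`).  Size M, provable now.  Sources: Bini1980,
BurgisserClausenShokrollahi1997 ((15.7), Prop. (15.26)), Blaser2013 (Lemma 6.4). -/
theorem stub_coefficientExtraction :
    ∀ n N : ℕ,
      (tensorRank (kroneckerPow (cliffordTensor ℂ n) N) : ℝ) ≤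
        (((n : ℝ) * N + 1) * ((n : ℝ) * N + 2) / 2) *
          (tensorRank (kroneckerPow (reesCliffordTensor ℂ n) N) : ℝ) := by
  sorry

/-- **Stub 3 — sub-exponential factors vanish at the exponent scale.**  For tensors `s, t` over `ℂ`
(finite formats) and `a ≥ 0`: if eventually in `N`, `R(s^{⊠N}) ≤ c · N^p · a^N · R(t^{⊠N})`, then
`R̃(s) ≤ a · R̃(t)`.  Proof sketch: `N`-th roots; `R(·^{⊠N})^{1/N} → R̃(·)` on both sides
(`advxxz2025_asymptoticRank_tendsto`, Fekete), `(c N^p)^{1/N} → 1`, `le_of_tendsto`; `s = 0` or `c ≤ 0`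
force `R̃(s) = 0`.  (`0 ≤ a` is needed: `c = 0`, `s = 0`, `a < 0`, `t ≠ 0` would otherwise be a
counterexample.)  Size S/M, provable now.  Sources: BurgisserClausenShokrollahi1997 (Lemma (15.27),
the one-tensor pattern), AlmanDuanVassilevskaWilliamsXuXuZhou2025 (§3.2), Blaser2013 (§9.2),
ChristandlVranaZuiddam2023 (§1.1). -/
theorem stub_asymptoticTransfer :
    ∀ {ι κ μ ι' κ' μ' : Type} [Fintype ι] [Fintype κ] [Fintype μ] [Fintype ι'] [Fintype κ']
      [Fintype μ'] (s : ι → κ → μ → ℂ) (t : ι' → κ' → μ' → ℂ) (a c : ℝ) (p : ℕ), 0 ≤ a →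
      (∀ᶠ N : ℕ in atTop, (tensorRank (kroneckerPow s N) : ℝ) ≤
          c * (N : ℝ) ^ p * a ^ N * (tensorRank (kroneckerPow t N) : ℝ)) →
      asymptoticRank s ≤ a * asymptoticRank t := by
  sorry

/-! ## Sorry-free core -/

/-- The Bini factor at `D = nN` is polynomial in `N` for fixed `n`:
`(nN+1)(nN+2)/2 ≤ (n+2)² N²` for `N ≥ 1`. [folklore] -/
theorem biniFactor_le (n N : ℕ) (hN : 1 ≤ N) :
    (((n : ℝ) * N + 1) * ((n : ℝ) * N + 2) / 2) ≤ ((n : ℝ) + 2) ^ 2 * (N : ℝ) ^ 2 := by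
  have hN' : (1 : ℝ) ≤ N := by exact_mod_cast hN
  have hn : (0 : ℝ) ≤ n := Nat.cast_nonneg n
  have hD : (0 : ℝ) ≤ (n : ℝ) * N := mul_nonneg hn (by linarith)
  have h1 : (((n : ℝ) * N + 1) * ((n : ℝ) * N + 2) / 2) ≤ ((n : ℝ) * N + 2) ^ 2 := by
    nlinarith
  have h2 : ((n : ℝ) * N + 2) ≤ ((n : ℝ) + 2) * N := by nlinarith
  have h3 : ((n : ℝ) * N + 2) ^ 2 ≤ (((n : ℝ) + 2) * N) ^ 2 :=
    pow_le_pow_left₀ (by linarith) h2 2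
  calc (((n : ℝ) * N + 1) * ((n : ℝ) * N + 2) / 2) ≤ ((n : ℝ) * N + 2) ^ 2 := h1
    _ ≤ (((n : ℝ) + 2) * N) ^ 2 := h3
    _ = ((n : ℝ) + 2) ^ 2 * (N : ℝ) ^ 2 := by ring

/-- **Composition with explicit hypotheses** (the BC3 shape `stub₁-sig → stub₂-sig → stub₃-sig →
crux-content`): from a Rees lift with sub-exponential padding (`hlift`, the statement of
`ReesLiftClifford` in named tensors), Bini extraction at `t = 1` (`hext`) and the sub-exponential
transfer (`htr`), the exponent inequality `R̃(T_{Cl_n}) ≤ 2^{εn} R̃(T_{Λ_n})` eventually in `n`, for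
every `ε > 0`.  Proof: lift at `ε/2`; for large `n`, eventually in `N`,
`R(T_{Cl_n}^{⊠N}) ≤ (nN+1)(nN+2)/2 · 2^{(ε/2)nN} R(T_{Λ_n}^{⊠N}) ≤ (n+2)² N² (2^{(ε/2)n})^N R(T_{Λ_n}^{⊠N})`,
transfer with `a = 2^{(ε/2)n}`, and `2^{(ε/2)n} ≤ 2^{εn}`.  Sorry-free, standard axioms. [folklore] -/
theorem cliffordReduction_of_lift_extraction_transfer
    (hlift : ∀ ε : ℝ, 0 < ε → ∀ᶠ n : ℕ in atTop, ∀ᶠ N : ℕ in atTop,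
      (tensorRank (kroneckerPow (reesCliffordTensor ℂ n) N) : ℝ) ≤
        (2 : ℝ) ^ (ε * n * N) * (tensorRank (kroneckerPow (exteriorTensor ℂ n) N) : ℝ))
    (hext : ∀ n N : ℕ,
      (tensorRank (kroneckerPow (cliffordTensor ℂ n) N) : ℝ) ≤
        (((n : ℝ) * N + 1) * ((n : ℝ) * N + 2) / 2) *
          (tensorRank (kroneckerPow (reesCliffordTensor ℂ n) N) : ℝ))
    (htr : ∀ {ι κ μ ι' κ' μ' : Type} [Fintype ι] [Fintype κ] [Fintype μ] [Fintype ι'] [Fintype κ']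
      [Fintype μ'] (s : ι → κ → μ → ℂ) (t : ι' → κ' → μ' → ℂ) (a c : ℝ) (p : ℕ), 0 ≤ a →
      (∀ᶠ N : ℕ in atTop, (tensorRank (kroneckerPow s N) : ℝ) ≤
          c * (N : ℝ) ^ p * a ^ N * (tensorRank (kroneckerPow t N) : ℝ)) →
      asymptoticRank s ≤ a * asymptoticRank t) :
    ∀ ε : ℝ, 0 < ε → ∀ᶠ n : ℕ in atTop,
      asymptoticRank (cliffordTensor ℂ n) ≤
        (2 : ℝ) ^ (ε * n) * asymptoticRank (exteriorTensor ℂ n) := by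
  intro ε hε
  have hε2 : 0 < ε / 2 := half_pos hε
  filter_upwards [hlift (ε / 2) hε2] with n hn
  -- the transfer rate `a = 2^{(ε/2) n}`
  set a : ℝ := (2 : ℝ) ^ (ε / 2 * n) with ha
  have ha0 : 0 ≤ a := by positivity
  have hpow : ∀ N : ℕ, (2 : ℝ) ^ (ε / 2 * n * N) = a ^ N := fun N => by
    rw [ha, ← Real.rpow_natCast, ← Real.rpow_mul (by norm_num : (0 : ℝ) ≤ 2)]
  -- finite level: `R(Cl^{⊠N}) ≤ (n+2)² · N² · a^N · R(Λ^{⊠N})` eventually in `N`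
  have key : ∀ᶠ N : ℕ in atTop, (tensorRank (kroneckerPow (cliffordTensor ℂ n) N) : ℝ) ≤
      ((n : ℝ) + 2) ^ 2 * (N : ℝ) ^ 2 * a ^ N *
        (tensorRank (kroneckerPow (exteriorTensor ℂ n) N) : ℝ) := by
    filter_upwards [hn, eventually_ge_atTop 1] with N hN hN1
    calc (tensorRank (kroneckerPow (cliffordTensor ℂ n) N) : ℝ)
        ≤ (((n : ℝ) * N + 1) * ((n : ℝ) * N + 2) / 2) *
            (tensorRank (kroneckerPow (reesCliffordTensor ℂ n) N) : ℝ) := hext n N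
      _ ≤ (((n : ℝ) * N + 1) * ((n : ℝ) * N + 2) / 2) *
            ((2 : ℝ) ^ (ε / 2 * n * N) *
              (tensorRank (kroneckerPow (exteriorTensor ℂ n) N) : ℝ)) :=
          mul_le_mul_of_nonneg_left hN (by positivity)
      _ ≤ (((n : ℝ) + 2) ^ 2 * (N : ℝ) ^ 2) *
            ((2 : ℝ) ^ (ε / 2 * n * N) *
              (tensorRank (kroneckerPow (exteriorTensor ℂ n) N) : ℝ)) :=
          mul_le_mul_of_nonneg_right (biniFactor_le n N hN1) (by positivity)
      _ = ((n : ℝ) + 2) ^ 2 * (N : ℝ) ^ 2 * a ^ N *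
            (tensorRank (kroneckerPow (exteriorTensor ℂ n) N) : ℝ) := by
          rw [hpow N]; ring
  -- exponent scale: the polynomial factor disappears
  have h := htr (cliffordTensor ℂ n) (exteriorTensor ℂ n) a (((n : ℝ) + 2) ^ 2) 2 ha0 key
  refine h.trans (mul_le_mul_of_nonneg_right ?_ (asymptoticRank_nonneg _))
  rw [ha]
  refine Real.rpow_le_rpow_of_exponent_le (by norm_num : (1 : ℝ) ≤ 2) ?_
  have hn0 : (0 : ℝ) ≤ n := Nat.cast_nonneg n
  nlinarith

/-! ## The composition: the three stubs prove the crux BY NAME -/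

/-- **THE SKELETON THEOREM.** The crux
`Summit.MatrixMultiplication.MatrixMultiplication.Theses.HenselReesLifting.CliffordReduction`
(stmt-MatrixMultiplication-3851), concluded BY NAME from the three DECLARED stubs `stub_reesLift`
(engine), `stub_coefficientExtraction` (Bini at `t = 1`) and `stub_asymptoticTransfer` (exponent
scale) — the only `sorry`s of the file — through the sorry-free core
`cliffordReduction_of_lift_extraction_transfer` and the `Iff.rfl` bridges. [folklore] -/
theorem CliffordReduction_of :
    Summit.MatrixMultiplication.MatrixMultiplication.Theses.HenselReesLifting.CliffordReduction :=
  cliffordReduction_iff.mpr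
    (cliffordReduction_of_lift_extraction_transfer (reesLiftClifford_iff.mp stub_reesLift)
      stub_coefficientExtraction stub_asymptoticTransfer)

end Summit.MatrixMultiplication.MatrixMultiplication.Cruxes.CliffordReduction.Birth

end
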